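import Summits.BirchSwinnertonDyer.Rank1Residual.X1.RankOneRegulatorSqueezeClass
import Summits.BirchSwinnertonDyer.Rank1Residual.X1.RankOneParitySqueezeLeaf
import Literature.NumberTheory.EllipticCurves.IsogenyCompProofs
import HarnessLib

/-!
# X1 ∩ {r = 1}: the CERTIFICATE-ROW record — one kernel theorem whose hypotheses are exactly a row of
# the cell's lane offer (`class-closure/N1/OFFER-T-X1R1-RP1-x1a.md`): route P₁ (`ord_p c₁ = 0`) OR
# route R (`ord_p c₁ = vc ≠ 0`, `v ≤ ord_p Reg_p`, the squeeze inequality), read on ANY curve of the class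

HONEST FRAMING (cell `b2b-bsdres`, run/shared/lean/b2b/bsd-rank1-residual/, verbatim in every
file): the goal of the cell is to DELETE the COMBINATION-SHAPED residual classes of the
Birch–Swinnerton-Dyer formula for ALL analytic-rank `≤ 1` elliptic curves over `ℚ` — "full BSD
formula for every rank `≤ 1` curve in class `C`" assembled STRICTLY from published theorems — so
that the rank-`≤ 1` remainder becomes exactly the CONSTRUCTION-SHAPED classes, which are TYPED
(missing-input `Prop`s), NOT attempted. This is not "finishing BSD". CLASS-OWNERS.md: row
"X1 (r = 1)" — research route; NO CLAIM BEYOND STATED CLASSES; no label change; nothing is booked by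
this file; no preprint enters; NO definition, NO named fact.

Unit `b2b-bsdres-x1a` (X1 prover A, gen 17). Fourth sequel of `X1/RankOneRegulatorSqueeze.lean`
(p263077). WHAT. The lane offer files, per rank-one N1/N1′ cell `(C, p)`, a curve `W′` of the
Cremona class `C` and ONE of two finite certificates, each read on two engines: route P₁ — the linear
coefficient of the Néron-normalised `p`-adic `L`-series of `W′` is a `p`-adic UNIT (x1b's
`RankOne.Leaf.mazurMainConjecture_and_bsdp_of_norm_coeff_one_eq_one`); route R — `ord_p` of that
coefficient is `vc ≠ 0`, `v ≤ ord_p Reg_p(W′)` at the canonical height, and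
`vc + 1 + 2·ord_p #W′(ℚ)_tors ≤ v + ord_p ∏c_ℓ(W′) + 2·ord_p #W̃′(𝔽_p)`
(`RankOne.Leaf.bsdp_of_isIsogenous_of_coeffOneVal_of_regulatorGE`). This file packages BOTH as a
single DISJUNCTIVE hypothesis (an `∨` of the two certificate shapes written inline; no definition,
no new object) and proves: (§1) the P₁ booking/isogeny form
(`Leaf.bsdp_of_isIsogenous_of_norm_coeff_one_eq_one`, which the tree lacked); (§2) **the row record**
`Leaf.bsdp_of_isIsogenous_of_certificateRow`: leaf pair `(W, p)`, `W′ ∼ W` globally minimal carrying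
a row ⇒ `BSDp W p`, from the PUBLISHED facts Wuthrich Thm. 16, BMS Thm. 1.7, Perrin-Riou 1987,
Mazur–Tate `σ`, modularity (`hmod`, `hmod'`), GZK, Cassels — and at `W = W′` Mazur's main conjecture
too; (§3) the class form `RankOne.statement_of_certificateRows` (⊇ `statement_of_regulatorCertificates`,
p265157). So every row of the offer instantiates ONE named theorem with ONE binder list.

References: [Wuthrich2014] Thm. 16; [BalakrishnanMullerStein2015] Thm. 1.7; [PerrinRiou1987] §1.4
Cor. 1.8; [MazurSteinTate2006] Thm. 1.3; [MilneADT2006] Thm. I.7.3; HOME/b2b-bsdres-x1a/X1-CHAIN.md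
§25–§26; HOME/class-closure/N1/OFFER-T-X1R1-RP1-x1a.md.
-/

noncomputable section

open scoped Classical MatrixGroups ModularForm

open PowerSeries CongruenceSubgroup WeierstrassCurve Literature.NumberTheory.EllipticCurves
  Literature.NumberTheory.EllipticCurves.ModularForms
  Literature.NumberTheory.EllipticCurves.Wuthrich2014
  Literature.NumberTheory.EllipticCurves.Rank1Residual
  Summit.BirchSwinnertonDyer.BirchSwinnertonDyer.Theorems
  Summit.BirchSwinnertonDyer.BirchSwinnertonDyer.Theorems.Rank1ResidualX1Defs
  Summit.BirchSwinnertonDyer.Rank1Residual.X1.RankOneLeadingTermSqueeze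

set_option autoImplicit false

namespace Summit.BirchSwinnertonDyer.Rank1Residual.X1.RankOne

variable {W : WeierstrassCurve ℚ} [W.IsElliptic] [W.IsGloballyMinimal] {p : ℕ} [Fact p.Prime]

/-! ## §1. Route P₁ — booking (isogeny) form -/

/-- **Route P₁ read on ANY globally minimal curve `E′ ∼ E` of the class:** for a leaf pair `(E, p)`
and `E′ ∼ E` whose Néron-normalised `p`-adic `L`-series has a UNIT linear coefficient
(`‖ϖ·[T¹]L_p(f,α)‖_p = 1` for the newform `f` of `E′`, `ϖ·Ω_{E′} = Ω⁺_f`), `BSD(E,p)` — by x1b's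
`Leaf.mazurMainConjecture_and_bsdp_of_norm_coeff_one_eq_one` at the leaf pair `(E′, p)`
(`Leaf.of_isIsogenous`) and Cassels' isogeny invariance of `BSD(·,p)` at analytic rank `≤ 1`
(`Rank1ResidualX1Isogeny.bsdp_iff_of_isIsogenous`). PUBLISHED inputs only (Wuthrich Thm. 16, BMS
Thm. 1.7, Perrin-Riou 1987, Mazur–Tate `σ`, modularity, GZK, Cassels). [cite: Wuthrich2014, Thm. 16 (p. 393)]
[cite: BalakrishnanMullerStein2015, Thm. 1.7] [cite: PerrinRiou1987, §1.4 Cor. 1.8]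
[cite: MilneADT2006, Thm. I.7.3] -/
theorem Leaf.bsdp_of_isIsogenous_of_norm_coeff_one_eq_one
    (hW16 : Wuthrich2014.charIdeal_dvd_padicLFunction) (hS : Schneider1985_order_charGenerator_odd)
    (hPR : perrinRiou_rankOne_leadingTerms_odd) (hMT : mazur_tate_sigma_exists_odd)
    (hmod : nonempty_modularParametrizationData) (hmod' : hasEntireLFunction_rat)
    (hGZK : rank_eq_analyticRank_of_analyticRank_le_one) (hCassels : bsdRHS_eq_of_isIsogenous)
    (hL : Leaf W p) {W' : WeierstrassCurve ℚ} [W'.IsElliptic] [W'.IsGloballyMinimal]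
    (hiso : IsIsogenous W W')
    (hcoeff : ∀ [NeZero (W'.conductorNorm ℤ)] (f : CuspForm (Gamma0 (W'.conductorNorm ℤ)) 2),
      IsNewformOf W' f → ∀ (ϖ : ℚ), (ϖ : ℝ) * W'.realPeriodRat = plusPeriod f →
      ‖coeff 1 (C (ϖ : ℚ_[p]) * padicLFunction f (unitRoot W' p : ℚ_[p]))‖ = 1) :
    BSDp W p :=
  (Rank1ResidualX1Isogeny.bsdp_iff_of_isIsogenous hGZK hmod' hCassels W W' hiso p (by rw [hL.2])).mpr
    ((hL.of_isIsogenous hiso).mazurMainConjecture_and_bsdp_of_norm_coeff_one_eq_one hW16 hS hPR hMT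
      hmod hGZK hcoeff).2

/-! ## §2. The certificate row (route P₁ ∨ route R) and its record -/

/-! A **certificate ROW at a pair `(E′, p)`** — exactly what one line of the lane offer carries — is
the DISJUNCTION (written inline in every statement below; no definition is introduced): EITHER
(route P₁) the Néron-normalised linear coefficient is a `p`-adic unit, OR (route R) integers `vc ≠ 0`,
`v` with `ord_p(ϖ·[T¹]L_p) = vc` (`AnalyticCoeffOneVal`), `v ≤ ord_p Reg_p(E′)` at the canonical
cyclotomic height, and `vc + 1 + 2·ord_p #E′(ℚ)_tors ≤ v + ord_p ∏c_ℓ(E′) + 2·ord_p #Ẽ′(𝔽_p)`. -/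

/-- **THE ROW RECORD, at the pair itself: a certificate row at a leaf pair `(E, p)` ⇒ Mazur's main
conjecture ∧ `BSD(E,p)`** (route P₁: x1b's unit-coefficient theorem; route R: the regulator squeeze,
p263077). PUBLISHED facts Wuthrich Thm. 16, BMS Thm. 1.7, Perrin-Riou 1987, Mazur–Tate `σ`,
modularity, GZK; no main-conjecture hypothesis, no Greenberg–Vatsal parity, no `#Ш_an`.
[cite: Wuthrich2014, Thm. 16 (p. 397)] [cite: BalakrishnanMullerStein2015, Thm. 1.7]
[cite: PerrinRiou1987, §1.4 Cor. 1.8] [cite: MazurSteinTate2006, Thm. 1.3] -/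
theorem Leaf.mazurMainConjecture_and_bsdp_of_certificateRow
    (hW16 : Wuthrich2014.charIdeal_dvd_padicLFunction) (hS : Schneider1985_order_charGenerator_odd)
    (hPR : perrinRiou_rankOne_leadingTerms_odd) (hMT : mazur_tate_sigma_exists_odd)
    (hmod : nonempty_modularParametrizationData) (hGZK : rank_eq_analyticRank_of_analyticRank_le_one)
    (hL : Leaf W p)
    (hrow : ((∀ [NeZero (W.conductorNorm ℤ)] (f : CuspForm (Gamma0 (W.conductorNorm ℤ)) 2),
        IsNewformOf W f → ∀ (ϖ : ℚ), (ϖ : ℝ) * W.realPeriodRat = plusPeriod f →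
        ‖coeff 1 (C (ϖ : ℚ_[p]) * padicLFunction f (unitRoot W p : ℚ_[p]))‖ = 1) ∨
      (∃ vc v : ℤ, vc ≠ 0 ∧ AnalyticCoeffOneVal W p vc ∧
        (∀ Dh : PAdicHeightData W p, Dh.IsCanonical → v ≤ (padicRegulator Dh).valuation) ∧
        vc + 1 + 2 * padicValNat p W.torsionOrder ≤
          v + padicValNat p W.tamagawaProduct + 2 * padicValNat p (W.reductionPointCount p)))) :
    MazurMainConjecture W p ∧ BSDp W p := by
  rcases hrow with hcoeff | ⟨vc, v, hvc, hc, hv, hb⟩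
  · exact hL.mazurMainConjecture_and_bsdp_of_norm_coeff_one_eq_one hW16 hS hPR hMT hmod hGZK hcoeff
  · exact hL.mazurMainConjecture_and_bsdp_of_coeffOneVal_of_regulatorGE hW16 hS hPR hMT hmod hGZK hvc
      hc hv hb

/-- **THE ROW RECORD, booking (isogeny) form: a leaf pair `(E, p)` and a globally minimal `E′ ∼ E`
carrying a certificate row ⇒ `BSD(E,p)`** (Cassels' isogeny invariance at analytic rank `≤ 1`;
`Leaf.of_isIsogenous`). This is the ONE theorem every line of the lane offer
`OFFER-T-X1R1-RP1-x1a.md` instantiates: binders `hW16 hS hPR hMT hmod hmod' hGZK hCassels` (eight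
published facts), per-row data `hL`, `hiso`, `hrow`. [cite: Wuthrich2014, Thm. 16 (p. 397)]
[cite: BalakrishnanMullerStein2015, Thm. 1.7] [cite: PerrinRiou1987, §1.4 Cor. 1.8]
[cite: MilneADT2006, Thm. I.7.3] -/
theorem Leaf.bsdp_of_isIsogenous_of_certificateRow
    (hW16 : Wuthrich2014.charIdeal_dvd_padicLFunction) (hS : Schneider1985_order_charGenerator_odd)
    (hPR : perrinRiou_rankOne_leadingTerms_odd) (hMT : mazur_tate_sigma_exists_odd)
    (hmod : nonempty_modularParametrizationData) (hmod' : hasEntireLFunction_rat)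
    (hGZK : rank_eq_analyticRank_of_analyticRank_le_one) (hCassels : bsdRHS_eq_of_isIsogenous)
    (hL : Leaf W p) {W' : WeierstrassCurve ℚ} [W'.IsElliptic] [W'.IsGloballyMinimal]
    (hiso : IsIsogenous W W')
    (hrow : ((∀ [NeZero (W'.conductorNorm ℤ)] (f : CuspForm (Gamma0 (W'.conductorNorm ℤ)) 2),
        IsNewformOf W' f → ∀ (ϖ : ℚ), (ϖ : ℝ) * W'.realPeriodRat = plusPeriod f →
        ‖coeff 1 (C (ϖ : ℚ_[p]) * padicLFunction f (unitRoot W' p : ℚ_[p]))‖ = 1) ∨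
      (∃ vc v : ℤ, vc ≠ 0 ∧ AnalyticCoeffOneVal W' p vc ∧
        (∀ Dh : PAdicHeightData W' p, Dh.IsCanonical → v ≤ (padicRegulator Dh).valuation) ∧
        vc + 1 + 2 * padicValNat p W'.torsionOrder ≤
          v + padicValNat p W'.tamagawaProduct + 2 * padicValNat p (W'.reductionPointCount p)))) :
    BSDp W p :=
  (Rank1ResidualX1Isogeny.bsdp_iff_of_isIsogenous hGZK hmod' hCassels W W' hiso p (by rw [hL.2])).mpr
    ((hL.of_isIsogenous hiso).mazurMainConjecture_and_bsdp_of_certificateRow hW16 hS hPR hMT hmod hGZK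
      hrow).2

/-- And `BSD(E′,p)` for EVERY globally minimal curve `E″` of the class at once (the census books
classes): leaf pair `(E, p)`, a row at `E′ ∼ E`, any `E″ ∼ E` ⇒ `BSDp E″ p`. [cite: MilneADT2006, Thm. I.7.3]
[cite: Wuthrich2014, Thm. 16 (p. 397)] -/
theorem Leaf.bsdp_of_isIsogenous_of_isIsogenous_of_certificateRow
    (hW16 : Wuthrich2014.charIdeal_dvd_padicLFunction) (hS : Schneider1985_order_charGenerator_odd)
    (hPR : perrinRiou_rankOne_leadingTerms_odd) (hMT : mazur_tate_sigma_exists_odd)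
    (hmod : nonempty_modularParametrizationData) (hmod' : hasEntireLFunction_rat)
    (hGZK : rank_eq_analyticRank_of_analyticRank_le_one) (hCassels : bsdRHS_eq_of_isIsogenous)
    (hL : Leaf W p) {W' : WeierstrassCurve ℚ} [W'.IsElliptic] [W'.IsGloballyMinimal]
    (hiso : IsIsogenous W W')
    (hrow : ((∀ [NeZero (W'.conductorNorm ℤ)] (f : CuspForm (Gamma0 (W'.conductorNorm ℤ)) 2),
        IsNewformOf W' f → ∀ (ϖ : ℚ), (ϖ : ℝ) * W'.realPeriodRat = plusPeriod f →
        ‖coeff 1 (C (ϖ : ℚ_[p]) * padicLFunction f (unitRoot W' p : ℚ_[p]))‖ = 1) ∨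
      (∃ vc v : ℤ, vc ≠ 0 ∧ AnalyticCoeffOneVal W' p vc ∧
        (∀ Dh : PAdicHeightData W' p, Dh.IsCanonical → v ≤ (padicRegulator Dh).valuation) ∧
        vc + 1 + 2 * padicValNat p W'.torsionOrder ≤
          v + padicValNat p W'.tamagawaProduct + 2 * padicValNat p (W'.reductionPointCount p))))
    {W'' : WeierstrassCurve ℚ} [W''.IsElliptic] [W''.IsGloballyMinimal] (hiso'' : IsIsogenous W W'') :
    BSDp W'' p :=
  (hL.of_isIsogenous hiso'').bsdp_of_isIsogenous_of_certificateRow hW16 hS hPR hMT hmod hmod' hGZK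
    hCassels (hiso''.symm_of_charZero.trans' hiso) hrow

/-! ## §3. Class form -/

/-- **`RankOne.Statement` ⇐ the eight PUBLISHED facts + a certificate row somewhere in the isogeny
class of every leaf pair** (route P₁ or route R; type-free; no main-conjecture hypothesis, no
Greenberg–Vatsal parity, no preprint) — the offer's class-level reading; contains
`statement_of_regulatorCertificates` (p265157). The residue of the class in this shape = leaf pairs
whose isogeny class carries NO row. [cite: Wuthrich2014, Thm. 16 (p. 397)]
[cite: BalakrishnanMullerStein2015, Thm. 1.7] [cite: PerrinRiou1987, §1.4 Cor. 1.8]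
[cite: MilneADT2006, Thm. I.7.3] -/
theorem statement_of_certificateRows
    (hW16 : Wuthrich2014.charIdeal_dvd_padicLFunction) (hS : Schneider1985_order_charGenerator_odd)
    (hPR : perrinRiou_rankOne_leadingTerms_odd) (hMT : mazur_tate_sigma_exists_odd)
    (hmod : nonempty_modularParametrizationData) (hmod' : hasEntireLFunction_rat)
    (hGZK : rank_eq_analyticRank_of_analyticRank_le_one) (hCassels : bsdRHS_eq_of_isIsogenous)
    (hrows : ∀ (W : WeierstrassCurve ℚ) [W.IsElliptic] [W.IsGloballyMinimal] (p : ℕ) [Fact p.Prime],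
      Leaf W p → ∃ (W' : WeierstrassCurve ℚ) (_ : W'.IsElliptic) (_ : W'.IsGloballyMinimal),
        IsIsogenous W W' ∧
      ((∀ [NeZero (W'.conductorNorm ℤ)] (f : CuspForm (Gamma0 (W'.conductorNorm ℤ)) 2),
        IsNewformOf W' f → ∀ (ϖ : ℚ), (ϖ : ℝ) * W'.realPeriodRat = plusPeriod f →
        ‖coeff 1 (C (ϖ : ℚ_[p]) * padicLFunction f (unitRoot W' p : ℚ_[p]))‖ = 1) ∨
      (∃ vc v : ℤ, vc ≠ 0 ∧ AnalyticCoeffOneVal W' p vc ∧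
        (∀ Dh : PAdicHeightData W' p, Dh.IsCanonical → v ≤ (padicRegulator Dh).valuation) ∧
        vc + 1 + 2 * padicValNat p W'.torsionOrder ≤
          v + padicValNat p W'.tamagawaProduct + 2 * padicValNat p (W'.reductionPointCount p)))) :
    Statement := by
  intro W _ _ p _ hL
  obtain ⟨W', _, _, hiso, hrow⟩ := hrows W p hL
  exact hL.bsdp_of_isIsogenous_of_certificateRow hW16 hS hPR hMT hmod hmod' hGZK hCassels hiso hrow

/-- And Mazur's main conjecture at every leaf pair carrying a row ON THE PAIR ITSELF.
[cite: Wuthrich2014, Thm. 16 (p. 397)] [cite: BalakrishnanMullerStein2015, Thm. 1.7] -/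
theorem forall_mazurMainConjecture_of_certificateRows
    (hW16 : Wuthrich2014.charIdeal_dvd_padicLFunction) (hS : Schneider1985_order_charGenerator_odd)
    (hPR : perrinRiou_rankOne_leadingTerms_odd) (hMT : mazur_tate_sigma_exists_odd)
    (hmod : nonempty_modularParametrizationData) (hGZK : rank_eq_analyticRank_of_analyticRank_le_one)
    (hrows : ∀ (W : WeierstrassCurve ℚ) [W.IsElliptic] [W.IsGloballyMinimal] (p : ℕ) [Fact p.Prime],
      Leaf W p →
      ((∀ [NeZero (W.conductorNorm ℤ)] (f : CuspForm (Gamma0 (W.conductorNorm ℤ)) 2),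
        IsNewformOf W f → ∀ (ϖ : ℚ), (ϖ : ℝ) * W.realPeriodRat = plusPeriod f →
        ‖coeff 1 (C (ϖ : ℚ_[p]) * padicLFunction f (unitRoot W p : ℚ_[p]))‖ = 1) ∨
      (∃ vc v : ℤ, vc ≠ 0 ∧ AnalyticCoeffOneVal W p vc ∧
        (∀ Dh : PAdicHeightData W p, Dh.IsCanonical → v ≤ (padicRegulator Dh).valuation) ∧
        vc + 1 + 2 * padicValNat p W.torsionOrder ≤
          v + padicValNat p W.tamagawaProduct + 2 * padicValNat p (W.reductionPointCount p)))) :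
    ∀ (W : WeierstrassCurve ℚ) [W.IsElliptic] [W.IsGloballyMinimal] (p : ℕ) [Fact p.Prime],
      Leaf W p → MazurMainConjecture W p :=
  fun W _ _ p _ hL ↦
    (hL.mazurMainConjecture_and_bsdp_of_certificateRow hW16 hS hPR hMT hmod hGZK (hrows W p hL)).1

end Summit.BirchSwinnertonDyer.Rank1Residual.X1.RankOne

end
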